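import Literature.NumberTheory.Automorphic.WhittakerModelsGelfandKazhdan
import Literature.NumberTheory.Automorphic.SupercuspidalRestriction
import Literature.NumberTheory.Automorphic.WhittakerModelsSupercuspidalHolds
import Literature.NumberTheory.Automorphic.MatrixCoefficientsSupercuspidalAdmissibleProofs
import HarnessLib

/-!
# The Gelfand–Kazhdan criterion for `GL_n(F)` in two-functional form, and uniqueness of
Whittaker functionals for supercuspidal representations modulo the Gelfand–Kazhdan lemma

Topic `NumberTheory/Automorphic`; a *proofs* file next to `WhittakerModels` and
`WhittakerModelsGelfandKazhdan` towards the named fact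
`Literature.NumberTheory.Automorphic.rank_whittakerFunctionals_le_one` (local multiplicity one).
Definitions with bodies and proved theorems only; no named fact is introduced.

## What is proved

`WhittakerModelsGelfandKazhdan` proves Bump's deduction (1997, pp. 457–459) of multiplicity one for
an irreducible admissible `π` from the two Gelfand–Kazhdan theorems: (A) every distribution `Δ` on
`GL_n(F)` with `Δ(λ(u) φ) = ψ_U(u) Δ(φ)`, `Δ(ρ(u) φ) = ψ_U(u)⁻¹ Δ(φ)` (`u ∈ U_n`) is stable under
`ι(g) = w⁰ ᵗg w⁰` (Bump, Thm. 4.4.2; Gelfand–Kazhdan 1975; Bernstein–Zelevinsky 1976, Thm. 5.17),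
and (B) `π̃ ≅ π ∘ (g ↦ ᵗg⁻¹)` (Gelfand–Kazhdan 1972, Thm. 1; Bump, Thm. 4.2.2 (i)). The only rôle of
(B) in that deduction is to produce, from a `ψ`-Whittaker functional `Λ₂` on `π`, a
`ψ⁻¹`-Whittaker functional `Λ₂ ∘ j⁻¹` on the contragredient `π̃`. This file proves the deduction in
the form that dispenses with (B) — the classical **two-functional form of the Gelfand–Kazhdan
criterion** (Gelfand–Kazhdan 1975, §2; Bernstein–Zelevinsky 1976, 5.16–5.17 and §7; Shalika 1974,
§2): for an irreducible admissible `π`,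

* `rank_whittakerFunctionals_le_one_of_gelfandKazhdan_pair`: (A) for `ψ` and for `ψ⁻¹`, together
  with the existence of ONE non-zero `ψ⁻¹`-Whittaker functional on the contragredient `π̃`, imply
  `Module.rank ℂ (whittakerFunctionals π ψ) ≤ 1`.

Since the contragredient of an irreducible supercuspidal representation is irreducible, admissible
and supercuspidal (`Representation.IsSupercuspidal.isAdmissible_of_sigmaCompactSpace`,
`Representation.isIrreducible_contragredient_holds`, `Representation.IsSupercuspidal.contragredientRep`,
all in the tree) and supercuspidal representations are generic for every non-trivial `ψ`
(`isGeneric_of_isSupercuspidal_holds`, the tree's proof of Gelfand–Kazhdan 1975, Thm. 8 /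
Bernstein–Zelevinsky 1977, Thm. 4.4), this gives

* `rank_whittakerFunctionals_le_one_of_isSupercuspidal_of_gelfandKazhdan`: **multiplicity one for
  irreducible supercuspidal representations of `GL_n(F)`** from (A) alone (for `ψ` and `ψ⁻¹`) —
  the cuspidal input ("Gelfand–Kazhdan, Theorem 4.4 (b)") of the Bernstein–Zelevinsky route to
  multiplicity one for all irreducible representations (Bernstein–Zelevinsky 1977, §4.7), whose
  other inputs (exactness of the twisted Jacquet functor, `WhittakerTwistedJacquet`; the Bruhat
  filtration, `ParabolicBruhatCells*`) are being assembled elsewhere in the tree.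

(A) itself (for all `n`) is not yet in the tree; it enters here, exactly as in
`WhittakerModelsGelfandKazhdan`, as the explicit hypotheses `hA` (for `ψ`) and `hA'` (for `ψ⁻¹`).

## The argument (Gelfand–Kazhdan 1975, §2; Bump 1997, pp. 457–459 with `j` removed)

Let `Λ₁ ≠ 0`, `Λ₂` be `ψ`-Whittaker functionals on `(π, V)` and `M ≠ 0` a `ψ⁻¹`-Whittaker
functional on `(π̃, Ṽ)`. Write `Λ ⋆ φ ∈ Ṽ` for the smeared functional
(`Representation.IsSmooth.smear`, Bump's (4.9)) and `τ(g) = ι(g⁻¹)` (`gkAutomorphism`).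

* **Swap lemma** (`smear_eq_zero_of_smear_eq_zero_pair`, Bump's Lemma 4.4.1 with `j` removed): for
  ANY irreducible admissible `ρ` on `W`, a non-zero `χ`-Whittaker functional `A` on `W` and a
  `χ'`-Whittaker functional `B` on `W̃` with `χ'_U = χ_U⁻¹`, hypothesis (A) for `χ` gives
  `A ⋆ φ = 0 ⇒ B ⋆ (φ ∘ τ) = 0`. Indeed `Δ(φ) = B(A ⋆ φ)` satisfies Bump's (4.1)
  (`pairDistribution_leftTranslate`, `pairDistribution_rightTranslate`), so is `ι`-stable; then
  (4.14)–(4.16) verbatim (finite coset sums in place of convolution) give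
  `(B ⋆ (φ ∘ τ))(A ⋆ σ) = 0` for all `σ`, and the `A ⋆ σ` fill `W̃` (`smearVec_surjective`:
  a non-zero `G`-stable subspace of the irreducible `W̃`, Bump's (4.17)).
* Apply the swap lemma to `(π, ψ, Λ₁, M)` and then to `(π̃, ψ⁻¹, M, Λ₂ ∘ β⁻¹)`, where
  `β : V ≃ Ṽ̃` is reflexivity of the admissible `π` (`bidualEquiv`, from the tree's
  `Representation.exists_eval_eq_of_mem_contragredient_contragredient`): since `τ² = 1`,
  `Λ₁ ⋆ φ = 0 ⇒ M ⋆ (φ ∘ τ) = 0 ⇒ Λ₂ ⋆ φ = 0`.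
* Hence `T (Λ₁ ⋆ φ) = Λ₂ ⋆ φ` is a well-defined intertwining operator of the irreducible admissible
  `π̃` (`isAdmissible_contragredient_holds`), a scalar `c` by Schur's lemma
  (`Representation.IsAdmissible.exists_eq_smul_id`), and `Λ₂ = c Λ₁` by the bump-function
  computation (4.18), exactly as in `WhittakerModelsGelfandKazhdan`.

## References

* I. M. Gelfand, D. A. Kazhdan, *Representations of the group GL(n, K) where K is a local field*,
  in: Lie groups and their representations (Budapest 1971), Halsted (1975), 95–118, §2.
  [GelfandKazhdan1975] Announcement: Funct. Anal. Appl. 6 (1972), Theorems 1 and 3.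
  [GelfandKazhdan1972]
* D. Bump, *Automorphic Forms and Representations* (1997), §4.4: Theorem 4.4.1 and 4.4.2 (p. 455),
  proof of Theorem 4.4.1 (pp. 457–459, (4.7)–(4.18), Lemma 4.4.1). [Bump1997]
* I. N. Bernstein, A. V. Zelevinsky, Russian Math. Surveys 31:3 (1976), 5.16–5.17, §7; Ann. Sci.
  ÉNS 10 (1977), Thm. 4.4, §4.7. [BernsteinZelevinskyRMS1976] [BernsteinZelevinskyASENS1977]
* J. A. Shalika, *The multiplicity one theorem for GL_n*, Ann. of Math. 100 (1974), §2.
  [Shalika1974]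
-/

open Matrix MeasureTheory MeasureTheory.Measure Topology
open scoped MatrixGroups NNReal ENNReal Pointwise

namespace Literature.NumberTheory.Automorphic

/-! ### Reflexivity `V ≃ Ṽ̃` of an admissible representation, as an intertwining isomorphism -/

section Bidual

variable {k G V : Type*} [Field k] [Group G] [TopologicalSpace G]
  [IsTopologicalGroup G] [AddCommGroup V] [Module k V] (ρ : Representation k G V)

/-- The evaluation map `V → (Ṽ)^*`, `v ↦ (λ ↦ λ(v))`. [folklore] -/
def evalContragredient : V →ₗ[k] Module.Dual k ρ.Contragredient where
  toFun v :=
    { toFun := fun lam => Representation.Contragredient.subtype ρ lam v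
      map_add' := fun _ _ => rfl
      map_smul' := fun _ _ => rfl }
  map_add' v w := LinearMap.ext fun lam => (Representation.Contragredient.subtype ρ lam).map_add v w
  map_smul' c v := LinearMap.ext fun lam => (Representation.Contragredient.subtype ρ lam).map_smul c v

/-- Unfolding lemma for `evalContragredient`. [folklore] -/
@[simp] lemma evalContragredient_apply (v : V) (lam : ρ.Contragredient) :
    evalContragredient ρ v lam = Representation.Contragredient.subtype ρ lam v := rfl

/-- Evaluation at a smooth vector is a smooth linear form on `Ṽ` (its stabiliser contains the
stabiliser of the vector). [folklore] -/
lemma evalContragredient_mem_contragredient (hρ : ρ.IsSmooth) (v : V) :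
    evalContragredient ρ v ∈ ρ.contragredientRep.contragredient := by
  rw [Representation.mem_contragredient]
  refine ρ.contragredientRep.dual.isSmoothVector_of_le (hρ v) fun g hg => ?_
  rw [Representation.mem_stabilizerSubgroup] at hg ⊢
  ext lam
  rw [Representation.dual_apply, Module.Dual.transpose_apply, LinearMap.comp_apply,
    evalContragredient_apply, evalContragredient_apply,
    Representation.subtype_contragredientRep_apply, Representation.dual_apply,
    Module.Dual.transpose_apply, LinearMap.comp_apply, inv_inv, hg]

variable [CharZero k]

/-- **Reflexivity of admissible representations as an isomorphism** `β : V ≃ Ṽ̃`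
(Bernstein–Zelevinsky 1976, Prop. 2.15; Bushnell–Henniart 2006, §2.9): evaluation is injective
because smooth forms separate points (`IsSmooth.exists_mem_contragredient_apply_ne_zero_of_mem_fixedPoints`)
and surjective by `Representation.exists_eval_eq_of_mem_contragredient_contragredient`. A compact
open subgroup `K₀` is taken as an argument (for `GL_n(F)`: `GL_n(𝒪)`).
[cite: BernsteinZelevinskyRMS1976, Proposition 2.15] -/
noncomputable def bidualEquiv (hρ : ρ.IsAdmissible) {K₀ : Subgroup G} (hK₀o : IsOpen (K₀ : Set G))
    (hK₀c : IsCompact (K₀ : Set G)) : V ≃ₗ[k] ρ.contragredientRep.Contragredient :=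
  LinearEquiv.ofBijective
    ((evalContragredient ρ).codRestrict ρ.contragredientRep.contragredient.toSubmodule
      fun v => evalContragredient_mem_contragredient ρ hρ.isSmooth v)
    ⟨by
      rw [injective_iff_map_eq_zero]
      intro v hv
      by_contra hv0
      set K : Subgroup G := K₀ ⊓ ρ.stabilizerSubgroup v with hKdef
      have hKo : IsOpen (K : Set G) := hK₀o.inter (hρ.isSmooth v)
      have hKc : IsCompact (K : Set G) :=
        hK₀c.of_isClosed_subset (Subgroup.isClosed_of_isOpen _ hKo) fun g hg => hg.1
      have hvK : v ∈ ρ.fixedPoints K := (ρ.mem_fixedPoints K v).2 fun g hg => hg.2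
      obtain ⟨f, hf, -, hfv⟩ :=
        hρ.isSmooth.exists_mem_contragredient_apply_ne_zero_of_mem_fixedPoints hKo hKc hvK hv0
      apply hfv
      exact congrArg (fun Φ : ρ.contragredientRep.contragredient.toSubmodule =>
        (Φ : Module.Dual k ρ.Contragredient) ⟨f, hf⟩) hv,
    fun Φ => by
      obtain ⟨v, hv⟩ := Representation.exists_eval_eq_of_mem_contragredient_contragredient
        hρ hK₀o hK₀c Φ.2
      exact ⟨v, Subtype.ext (LinearMap.ext fun lam => (hv lam).symm)⟩⟩

/-- `β(v)(λ) = λ(v)`. [folklore] -/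
lemma bidualEquiv_apply_apply (hρ : ρ.IsAdmissible) {K₀ : Subgroup G} (hK₀o : IsOpen (K₀ : Set G))
    (hK₀c : IsCompact (K₀ : Set G)) (v : V) (lam : ρ.Contragredient) :
    Representation.Contragredient.subtype ρ.contragredientRep (bidualEquiv ρ hρ hK₀o hK₀c v) lam =
      Representation.Contragredient.subtype ρ lam v := rfl

/-- **`β` is an intertwining operator**: `β(ρ(g) v) = ρ̃̃(g) β(v)`. [folklore] -/
lemma bidualEquiv_apply_apply' (hρ : ρ.IsAdmissible) {K₀ : Subgroup G} (hK₀o : IsOpen (K₀ : Set G))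
    (hK₀c : IsCompact (K₀ : Set G)) (g : G) (v : V) :
    bidualEquiv ρ hρ hK₀o hK₀c (ρ g v) =
      ρ.contragredientRep.contragredientRep g (bidualEquiv ρ hρ hK₀o hK₀c v) := by
  apply Representation.Contragredient.subtype_injective
  ext lam
  rw [bidualEquiv_apply_apply, Representation.subtype_contragredientRep_apply,
    Representation.dual_apply, Module.Dual.transpose_apply, LinearMap.comp_apply,
    bidualEquiv_apply_apply, Representation.subtype_contragredientRep_apply,
    Representation.dual_apply, Module.Dual.transpose_apply, LinearMap.comp_apply, inv_inv]

/-- `β⁻¹` intertwines as well: `β⁻¹(ρ̃̃(g) y) = ρ(g) β⁻¹(y)`. [folklore] -/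
lemma bidualEquiv_symm_apply (hρ : ρ.IsAdmissible) {K₀ : Subgroup G} (hK₀o : IsOpen (K₀ : Set G))
    (hK₀c : IsCompact (K₀ : Set G)) (g : G) (y : ρ.contragredientRep.Contragredient) :
    (bidualEquiv ρ hρ hK₀o hK₀c).symm (ρ.contragredientRep.contragredientRep g y) =
      ρ g ((bidualEquiv ρ hρ hK₀o hK₀c).symm y) := by
  apply (bidualEquiv ρ hρ hK₀o hK₀c).injective
  rw [LinearEquiv.apply_symm_apply, bidualEquiv_apply_apply', LinearEquiv.apply_symm_apply]

end Bidual

/-! ### The Gelfand–Kazhdan criterion in two-functional form -/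

section PairCriterion

open GaloisRepresentations (glTransposeInv)

variable {F : Type*} [Field F] [TopologicalSpace F] [ValuativeRel F] [IsNonarchimedeanLocalField F]
  {n : ℕ}

attribute [local instance] t2Space_generalLinearGroup locallyCompactSpace_generalLinearGroup
  nonarchimedeanGroup_gl sigmaCompactSpace_generalLinearGroup

/-- The automorphism `φ ↦ φ ∘ τ`, `τ(g) = ι(g⁻¹) = w⁰ ᵗg⁻¹ w⁰`, of `C_c^∞(GL_n(F))`. [folklore] -/
def SchwartzBruhat.compGKAutomorphism :
    SchwartzBruhat (GL (Fin n) F) →ₗ[ℂ] SchwartzBruhat (GL (Fin n) F) where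
  toFun φ := ⟨fun g => (φ : GL (Fin n) F → ℂ) (gkInvolution g⁻¹),
    comp_inv_mem_schwartzBruhat (SchwartzBruhat.compGKInvolution φ).2⟩
  map_add' _ _ := rfl
  map_smul' _ _ := rfl

/-- Unfolding lemma for `SchwartzBruhat.compGKAutomorphism`. [folklore] -/
@[simp] lemma SchwartzBruhat.compGKAutomorphism_apply (φ : SchwartzBruhat (GL (Fin n) F))
    (g : GL (Fin n) F) :
    (SchwartzBruhat.compGKAutomorphism φ : GL (Fin n) F → ℂ) g =
      (φ : GL (Fin n) F → ℂ) (gkInvolution g⁻¹) := rfl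

/-- `τ` is an involution: `(φ ∘ τ) ∘ τ = φ`. [folklore] -/
lemma SchwartzBruhat.compGKAutomorphism_compGKAutomorphism (φ : SchwartzBruhat (GL (Fin n) F)) :
    SchwartzBruhat.compGKAutomorphism (SchwartzBruhat.compGKAutomorphism φ) = φ := by
  apply Subtype.ext
  funext g
  simp only [SchwartzBruhat.compGKAutomorphism_apply, gkInvolution_inv, inv_inv,
    gkInvolution_gkInvolution]

variable {V : Type*} [AddCommGroup V] [Module ℂ V] {π : Representation ℂ (GL (Fin n) F) V}
  [MeasurableSpace (GL (Fin n) F)] [BorelSpace (GL (Fin n) F)]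
  (μ : Measure (GL (Fin n) F)) [IsHaarMeasure μ] [μ.IsMulRightInvariant]

/-- The smeared functional `Λ ⋆ φ` as an element of the contragredient `Ṽ` (Bump 1997, (4.9) and
"`Λ ⋆ φ` is smooth", p. 458), linear in `φ`. [cite: Bump1997, (4.9), p. 458] -/
noncomputable def smearVec (hπ : π.IsSmooth) (Λ : Module.Dual ℂ V) :
    SchwartzBruhat (GL (Fin n) F) →ₗ[ℂ] π.Contragredient :=
  (hπ.smear μ Λ).codRestrict π.contragredient.toSubmodule
    fun φ => smear_mem_contragredient_gl μ hπ Λ φ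

/-- The linear form underlying `smearVec … Λ φ` is `Λ ⋆ φ`. [folklore] -/
@[simp] lemma subtype_smearVec (hπ : π.IsSmooth) (Λ : Module.Dual ℂ V)
    (φ : SchwartzBruhat (GL (Fin n) F)) :
    Representation.Contragredient.subtype π (smearVec μ hπ Λ φ) = hπ.smear μ Λ φ := rfl

/-- `smearVec … Λ φ = 0 ↔ Λ ⋆ φ = 0`. [folklore] -/
lemma smearVec_eq_zero_iff (hπ : π.IsSmooth) (Λ : Module.Dual ℂ V)
    (φ : SchwartzBruhat (GL (Fin n) F)) :
    smearVec μ hπ Λ φ = 0 ↔ hπ.smear μ Λ φ = 0 := by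
  rw [← subtype_smearVec μ hπ Λ φ]
  exact ⟨fun h => by rw [h, map_zero],
    fun h => Representation.Contragredient.subtype_injective π (by rw [h, map_zero])⟩

/-- **Bump's (4.10)** for the contragredient: `π̃(a) (Λ ⋆ φ) = Λ ⋆ ρ(a) φ`.
[cite: Bump1997, (4.10), p. 458] -/
lemma contragredientRep_smearVec (hπ : π.IsSmooth) (Λ : Module.Dual ℂ V) (a : GL (Fin n) F)
    (φ : SchwartzBruhat (GL (Fin n) F)) :
    π.contragredientRep a (smearVec μ hπ Λ φ) =
      smearVec μ hπ Λ (SchwartzBruhat.rightTranslate a φ) := by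
  apply Representation.Contragredient.subtype_injective
  rw [Representation.subtype_contragredientRep_apply, subtype_smearVec, subtype_smearVec,
    hπ.dual_smear μ]

variable (ψ : AddChar F Circle)

/-- **Bump's (4.12)**: for a Whittaker functional `Λ`, `Λ ⋆ λ(u) φ = ψ_U(u) (Λ ⋆ φ)` in `Ṽ`.
[cite: Bump1997, (4.12), p. 458] -/
lemma smearVec_leftTranslate (hπ : π.IsSmooth) {Λ : Module.Dual ℂ V}
    (hΛ : Λ ∈ whittakerFunctionals π ψ) (u : ↥(upperUnitriangular (Fin n) F))
    (φ : SchwartzBruhat (GL (Fin n) F)) :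
    smearVec μ hπ Λ (SchwartzBruhat.leftTranslate (u : GL (Fin n) F) φ) =
      (whittakerCharFun ψ u : ℂ) • smearVec μ hπ Λ φ := by
  apply Representation.Contragredient.subtype_injective
  rw [map_smul, subtype_smearVec, subtype_smearVec,
    hπ.smear_leftTranslate μ ((mem_whittakerFunctionals_iff Λ).1 hΛ u)]

/-- **Bump's (4.17)**: for a non-zero linear form `Λ` on an irreducible admissible `π`, the
smeared functionals `Λ ⋆ σ`, `σ ∈ C_c^∞(G)`, fill the contragredient `Ṽ`: they form a non-zero
(bump functions) `G`-stable ((4.10)) subspace of `Ṽ`, which is irreducible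
(`Representation.isIrreducible_contragredient_holds`). [cite: Bump1997, (4.17), p. 459] -/
theorem smearVec_surjective [π.IsIrreducible] (hadm : π.IsAdmissible) {Λ : Module.Dual ℂ V}
    (hΛ : Λ ≠ 0) : Function.Surjective (smearVec μ hadm.isSmooth Λ) := by
  haveI hirr : π.contragredientRep.IsIrreducible :=
    Representation.isIrreducible_contragredient_holds π hadm
  let W : Subrepresentation π.contragredientRep :=
    ⟨LinearMap.range (smearVec μ hadm.isSmooth Λ), fun g v hv => by
      obtain ⟨σ, rfl⟩ := hv
      exact ⟨_, (contragredientRep_smearVec μ hadm.isSmooth Λ g σ).symm⟩⟩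
  obtain ⟨ξ, hξ⟩ : ∃ ξ, Λ ξ ≠ 0 := by
    by_contra h
    push Not at h
    exact hΛ (LinearMap.ext h)
  obtain ⟨K, hKo, hKc, hKξ⟩ := exists_isCompact_isOpen_le_stabilizer hadm.isSmooth ξ
  have hne : smearVec μ hadm.isSmooth Λ ⟨_, indicator_mem_schwartzBruhat hKo hKc⟩ ≠ 0 := by
    rw [Ne, smearVec_eq_zero_iff]
    intro h0
    have := LinearMap.congr_fun h0 ξ
    rw [hadm.isSmooth.smear_indicator_apply μ Λ hKo hKc hKξ, LinearMap.zero_apply,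
      mul_eq_zero] at this
    rcases this with h1 | h1
    · exact (measureReal_pos_of_isCompact_isOpen μ hKo hKc).ne' (by exact_mod_cast h1)
    · exact hξ h1
  have hW : W = ⊤ := (eq_bot_or_eq_top W).resolve_left fun h => hne (by
    have hmem : smearVec μ hadm.isSmooth Λ ⟨_, indicator_mem_schwartzBruhat hKo hKc⟩ ∈ W :=
      ⟨_, rfl⟩
    rwa [h, Subrepresentation.mem_bot_iff] at hmem)
  exact LinearMap.range_eq_top.1 (congrArg Subrepresentation.toSubmodule hW)

/-! #### The distribution `Δ(φ) = B(A ⋆ φ)` attached to a pair of functionals -/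

/-- **The Gelfand–Kazhdan distribution of a pair** `(A, B)`, `A` a linear form on `V` and `B` a
linear form on `Ṽ`: `Δ(φ) = B(A ⋆ φ)` (Bump 1997, (4.13), with `Λ₂ ∘ j⁻¹` replaced by an
arbitrary form `B` on `Ṽ`; Gelfand–Kazhdan 1975, §2). [cite: Bump1997, (4.13), p. 458] -/
noncomputable def pairDistribution (hπ : π.IsSmooth) (A : Module.Dual ℂ V)
    (B : Module.Dual ℂ π.Contragredient) : Module.Dual ℂ (SchwartzBruhat (GL (Fin n) F)) :=
  B ∘ₗ smearVec μ hπ A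

/-- Unfolding lemma for `pairDistribution`. [folklore] -/
lemma pairDistribution_apply (hπ : π.IsSmooth) (A : Module.Dual ℂ V)
    (B : Module.Dual ℂ π.Contragredient) (φ : SchwartzBruhat (GL (Fin n) F)) :
    pairDistribution μ hπ A B φ = B (smearVec μ hπ A φ) := rfl

/-- `Δ` satisfies the left half of Bump's (4.1): `Δ(λ(u) φ) = ψ_U(u) Δ(φ)`.
[cite: Bump1997, (4.1), p. 455] -/
lemma pairDistribution_leftTranslate (hπ : π.IsSmooth)
    {A : Module.Dual ℂ V} (hA : A ∈ whittakerFunctionals π ψ) (B : Module.Dual ℂ π.Contragredient)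
    (u : ↥(upperUnitriangular (Fin n) F)) (φ : SchwartzBruhat (GL (Fin n) F)) :
    pairDistribution μ hπ A B (SchwartzBruhat.leftTranslate (u : GL (Fin n) F) φ) =
      whittakerCharFun ψ u * pairDistribution μ hπ A B φ := by
  rw [pairDistribution_apply, pairDistribution_apply, smearVec_leftTranslate μ ψ hπ hA,
    map_smul, smul_eq_mul]

/-- `Δ` satisfies the right half of Bump's (4.1): `Δ(ρ(u) φ) = ψ_U(u)⁻¹ Δ(φ)`, when `B` is a
`ψ'`-Whittaker functional on `Ṽ` with `ψ'_U = ψ_U⁻¹`. [cite: Bump1997, (4.1), p. 455] -/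
lemma pairDistribution_rightTranslate (hπ : π.IsSmooth) (A : Module.Dual ℂ V) {ψ' : AddChar F Circle}
    (hψ' : ∀ u : ↥(upperUnitriangular (Fin n) F), whittakerCharFun ψ' u = (whittakerCharFun ψ u)⁻¹)
    {B : Module.Dual ℂ π.Contragredient} (hB : B ∈ whittakerFunctionals π.contragredientRep ψ')
    (u : ↥(upperUnitriangular (Fin n) F)) (φ : SchwartzBruhat (GL (Fin n) F)) :
    pairDistribution μ hπ A B (SchwartzBruhat.rightTranslate (u : GL (Fin n) F) φ) =
      (whittakerCharFun ψ u)⁻¹ * pairDistribution μ hπ A B φ := by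
  rw [pairDistribution_apply, pairDistribution_apply, ← contragredientRep_smearVec μ hπ,
    (mem_whittakerFunctionals_iff B).1 hB u, hψ']

/-! #### The swap lemma (Bump's Lemma 4.4.1 with `j` removed) -/

/-- **The swap lemma** (Gelfand–Kazhdan 1975, §2; Bump 1997, Lemma 4.4.1, p. 459, with Bump's
`Λ₂ ∘ j⁻¹` replaced by an arbitrary Whittaker functional on the contragredient). Let `π` be
irreducible admissible, `A ≠ 0` a `ψ`-Whittaker functional on `V`, `B` a `ψ'`-Whittaker functional
on `Ṽ` with `ψ'_U = ψ_U⁻¹`, and assume (A) (Bump, Thm. 4.4.2) for `ψ`. If `A ⋆ φ = 0` then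
`B ⋆ (φ ∘ τ) = 0`, `τ(g) = ι(g⁻¹)`. Printed proof, followed verbatim: `A ⋆ ρ(g) φ = 0` for all `g`
(4.10), so by `ι`-stability of `Δ = B(A ⋆ ·)`, `Δ(λ(b) ιφ) = 0` for all `b` (4.14); integrating
against `σ(b)` by finite coset sums, `∫ ιφ(c⁻¹) Δ(ρ(c) σ) dc = 0` (4.15), and this integral is
`(B ⋆ (φ ∘ τ))(A ⋆ σ)` (4.16); the `A ⋆ σ` fill `Ṽ` (4.17). [cite: Bump1997, Lemma 4.4.1, p. 459] -/
theorem smear_eq_zero_of_smear_eq_zero_pair [μ.Regular] [π.IsIrreducible] (hadm : π.IsAdmissible)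
    (hA : ∀ Δ : Module.Dual ℂ (SchwartzBruhat (GL (Fin n) F)),
      (∀ (u : ↥(upperUnitriangular (Fin n) F)) (φ : SchwartzBruhat (GL (Fin n) F)),
        Δ (SchwartzBruhat.leftTranslate (u : GL (Fin n) F) φ) = whittakerCharFun ψ u * Δ φ) →
      (∀ (u : ↥(upperUnitriangular (Fin n) F)) (φ : SchwartzBruhat (GL (Fin n) F)),
        Δ (SchwartzBruhat.rightTranslate (u : GL (Fin n) F) φ) = (whittakerCharFun ψ u)⁻¹ * Δ φ) →
      ∀ φ, Δ (SchwartzBruhat.compGKInvolution φ) = Δ φ)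
    {A : Module.Dual ℂ V} (hAψ : A ∈ whittakerFunctionals π ψ) (hA0 : A ≠ 0)
    {ψ' : AddChar F Circle}
    (hψ' : ∀ u : ↥(upperUnitriangular (Fin n) F), whittakerCharFun ψ' u = (whittakerCharFun ψ u)⁻¹)
    {B : Module.Dual ℂ π.Contragredient} (hB : B ∈ whittakerFunctionals π.contragredientRep ψ')
    {φ : SchwartzBruhat (GL (Fin n) F)} (h : hadm.isSmooth.smear μ A φ = 0) :
    π.isSmooth_contragredientRep.smear μ B (SchwartzBruhat.compGKAutomorphism φ) = 0 := by
  set D := pairDistribution μ hadm.isSmooth A B with hD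
  have hιΔ : ∀ φ, D (SchwartzBruhat.compGKInvolution φ) = D φ :=
    hA D (pairDistribution_leftTranslate μ ψ hadm.isSmooth hAψ B)
      (pairDistribution_rightTranslate μ ψ hadm.isSmooth A hψ' hB)
  set θ := SchwartzBruhat.compGKInvolution φ with hθ
  -- (4.14): `Δ(λ(b) θ) = 0` for all `b`
  have hb : ∀ b : GL (Fin n) F, D (SchwartzBruhat.leftTranslate b θ) = 0 := by
    intro b
    have hρ : SchwartzBruhat.leftTranslate b θ =
        SchwartzBruhat.compGKInvolution (SchwartzBruhat.rightTranslate (gkInvolution b⁻¹) φ) := by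
      rw [SchwartzBruhat.compGKInvolution_rightTranslate, gkInvolution_gkInvolution, inv_inv]
    rw [hρ, hιΔ, hD, pairDistribution_apply,
      (smearVec_eq_zero_iff μ hadm.isSmooth A _).2
        (hadm.isSmooth.smear_rightTranslate_eq_zero μ h _), map_zero]
  -- (4.15): `∫ θ(c⁻¹) Δ(ρ(c) σ) dc = 0` for every test function `σ`
  have hc : ∀ σ : SchwartzBruhat (GL (Fin n) F),
      ∫ c, (θ : GL (Fin n) F → ℂ) c⁻¹ * D (SchwartzBruhat.rightTranslate c σ) ∂μ = 0 := by
    intro σ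
    obtain ⟨K, hKo, hKc, hσR, -, -, hθL⟩ := exists_isCompact_isOpen_forall_mul_eq₂ σ.2 θ.2
    have hρK : ∀ k ∈ K, SchwartzBruhat.rightTranslate k σ = σ := fun k hk =>
      Subtype.ext (funext fun x => hσR k hk x)
    have hf₁ : (fun c => (θ : GL (Fin n) F → ℂ) c⁻¹) ∈ SchwartzBruhat (GL (Fin n) F) :=
      comp_inv_mem_schwartzBruhat θ.2
    have hf₁K : ∀ k ∈ K, ∀ c, (θ : GL (Fin n) F → ℂ) (c * k)⁻¹ = (θ : GL (Fin n) F → ℂ) c⁻¹ :=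
      fun k hk c => by rw [_root_.mul_inv_rev]; exact hθL k⁻¹ (K.inv_mem hk) _
    obtain ⟨C₁, hC₁⟩ := exists_finset_quotient_of_hasCompactSupport hf₁.2 hKo
    obtain ⟨C₂, hC₂⟩ := exists_finset_quotient_of_hasCompactSupport σ.2.2 hKo
    have hI : ∫ c, (θ : GL (Fin n) F → ℂ) c⁻¹ * D (SchwartzBruhat.rightTranslate c σ) ∂μ =
        D (∑ q ∈ C₁, ((μ.real (K : Set (GL (Fin n) F)) : ℂ) * (θ : GL (Fin n) F → ℂ) q.out⁻¹) •
          SchwartzBruhat.rightTranslate q.out σ) := by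
      rw [integral_mul_eq_finset_sum μ hKo hKc hf₁K hC₁ (Φ := fun c =>
        D (SchwartzBruhat.rightTranslate c σ)) fun k hk c => by
          simp only [SchwartzBruhat.rightTranslate_mul, hρK k hk]]
      simp only [_root_.map_sum, map_smul, smul_eq_mul, mul_assoc]
    have hS : (∑ q ∈ C₁, ((μ.real (K : Set (GL (Fin n) F)) : ℂ) * (θ : GL (Fin n) F → ℂ) q.out⁻¹) •
          SchwartzBruhat.rightTranslate q.out σ) =
        ∑ q ∈ C₂, ((μ.real (K : Set (GL (Fin n) F)) : ℂ) * (σ : GL (Fin n) F → ℂ) q.out) •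
          SchwartzBruhat.leftTranslate q.out θ := by
      apply Subtype.ext
      funext x
      have h₁ := integral_mul_eq_finset_sum μ hKo hKc hf₁K hC₁
        (Φ := fun c => (σ : GL (Fin n) F → ℂ) (x * c)) fun k hk c => by
          simp only [← mul_assoc, hσR k hk]
      have h₂ := integral_mul_eq_finset_sum μ hKo hKc hσR hC₂
        (Φ := fun b => (θ : GL (Fin n) F → ℂ) (b⁻¹ * x)) fun k hk b => by
          simp only [_root_.mul_inv_rev, mul_assoc, hθL k⁻¹ (K.inv_mem hk)]
      have h₁₂ : ∫ b, (σ : GL (Fin n) F → ℂ) b * (θ : GL (Fin n) F → ℂ) (b⁻¹ * x) ∂μ =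
          ∫ c, (θ : GL (Fin n) F → ℂ) c⁻¹ * (σ : GL (Fin n) F → ℂ) (x * c) ∂μ := by
        rw [← integral_mul_left_eq_self _ x]
        congr 1
        funext c
        rw [_root_.mul_inv_rev, inv_mul_cancel_right, mul_comm]
      simp only [Submodule.coe_sum, Submodule.coe_smul, Finset.sum_apply, Pi.smul_apply,
        SchwartzBruhat.rightTranslate_apply, SchwartzBruhat.leftTranslate_apply, smul_eq_mul]
      simp only [mul_assoc] at h₁ h₂ ⊢
      rw [← h₁, ← h₁₂, h₂]
    rw [hI, hS, _root_.map_sum]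
    refine Finset.sum_eq_zero fun q _ => ?_
    rw [map_smul, hb, smul_zero]
  -- (4.16): `(B ⋆ (φ ∘ τ))(A ⋆ σ) = 0`
  have hd : ∀ σ : SchwartzBruhat (GL (Fin n) F),
      π.isSmooth_contragredientRep.smear μ B (SchwartzBruhat.compGKAutomorphism φ)
        (smearVec μ hadm.isSmooth A σ) = 0 := by
    intro σ
    rw [Representation.IsSmooth.smear_apply_apply]
    have heq : (fun g => (SchwartzBruhat.compGKAutomorphism φ : GL (Fin n) F → ℂ) g *
        B (π.contragredientRep g (smearVec μ hadm.isSmooth A σ))) =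
        fun c => (θ : GL (Fin n) F → ℂ) c⁻¹ * D (SchwartzBruhat.rightTranslate c σ) := by
      funext g
      rw [SchwartzBruhat.compGKAutomorphism_apply, hθ, SchwartzBruhat.compGKInvolution_apply,
        contragredientRep_smearVec μ hadm.isSmooth, hD, pairDistribution_apply]
    rw [heq, hc]
  -- (4.17): the `A ⋆ σ` exhaust `Ṽ`
  apply LinearMap.ext
  intro x
  obtain ⟨σ, rfl⟩ := smearVec_surjective μ hadm hA0 x
  rw [hd, LinearMap.zero_apply]

/-! #### The theorem -/

omit [TopologicalSpace F] [ValuativeRel F] [IsNonarchimedeanLocalField F]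
  [MeasurableSpace (GL (Fin n) F)] [BorelSpace (GL (Fin n) F)] in
/-- `ψ⁻¹_U = ψ_U⁻¹`. [folklore] -/
lemma whittakerCharFun_inv (u : ↥(upperUnitriangular (Fin n) F)) :
    whittakerCharFun ψ⁻¹ u = (whittakerCharFun ψ u)⁻¹ := by
  rw [whittakerCharFun_apply, whittakerCharFun_apply, AddChar.inv_apply', Circle.coe_inv]

omit [TopologicalSpace F] [ValuativeRel F] [IsNonarchimedeanLocalField F]
  [MeasurableSpace (GL (Fin n) F)] [BorelSpace (GL (Fin n) F)] in
/-- `(ψ⁻¹)⁻¹_U = ψ_U`, in the form `ψ_U = (ψ⁻¹_U)⁻¹`. [folklore] -/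
lemma whittakerCharFun_eq_inv_inv (u : ↥(upperUnitriangular (Fin n) F)) :
    whittakerCharFun ψ u = (whittakerCharFun ψ⁻¹ u)⁻¹ := by
  rw [whittakerCharFun_apply, whittakerCharFun_apply, AddChar.inv_apply', Circle.coe_inv, inv_inv]

/-- **Uniqueness of Whittaker functionals from the Gelfand–Kazhdan lemma, two-functional form**
(Gelfand–Kazhdan 1975, §2; Bernstein–Zelevinsky 1976, 5.16–5.17; Bump 1997, proof of Thm. 4.4.1
with the rôle of Thm. 4.2.2 (i) isolated). Let `π` be an irreducible admissible representation of
`GL_n(F)` on `V`. Assume (A) — Bump's Theorem 4.4.2: bi-`ψ_U`-quasi-invariant distributions are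
`ι`-stable — for `ψ` (`hA`) and for `ψ⁻¹` (`hA'`), and that the contragredient `π̃` admits a
non-zero `ψ⁻¹`-Whittaker functional (`hM`; under Gelfand–Kazhdan's Theorem B = Bump's 4.2.2 (i)
this follows from `π` being `ψ`-generic, and for supercuspidal `π` it holds outright, see below).
Then `dim Hom_{U_n}(π, ψ_U) ≤ 1`. Proof: for Whittaker functionals `Λ₁ ≠ 0`, `Λ₂` on `V` and
`M ≠ 0` on `Ṽ`, the swap lemma for `(π, ψ, Λ₁, M)` and then for `(π̃, ψ⁻¹, M, Λ₂ ∘ β⁻¹)`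
(`β : V ≃ Ṽ̃` reflexivity) gives `Λ₁ ⋆ φ = 0 ⇒ M ⋆ (φ ∘ τ) = 0 ⇒ Λ₂ ⋆ φ = 0` (`τ² = 1`); so
`T (Λ₁ ⋆ φ) = Λ₂ ⋆ φ` is an intertwining operator of the irreducible admissible `π̃`, a scalar by
Schur's lemma, and `Λ₂ = c Λ₁` by the bump-function computation (Bump's (4.18)).
[cite: GelfandKazhdan1975, §2] [cite: Bump1997, Theorem 4.4.1, pp. 457–459] -/
theorem rank_whittakerFunctionals_le_one_of_gelfandKazhdan_pair
    (π : Representation ℂ (GL (Fin n) F) V) (ψ : AddChar F Circle) [π.IsIrreducible]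
    (hadm : π.IsAdmissible)
    (hA : ∀ Δ : Module.Dual ℂ (SchwartzBruhat (GL (Fin n) F)),
      (∀ (u : ↥(upperUnitriangular (Fin n) F)) (φ : SchwartzBruhat (GL (Fin n) F)),
        Δ (SchwartzBruhat.leftTranslate (u : GL (Fin n) F) φ) = whittakerCharFun ψ u * Δ φ) →
      (∀ (u : ↥(upperUnitriangular (Fin n) F)) (φ : SchwartzBruhat (GL (Fin n) F)),
        Δ (SchwartzBruhat.rightTranslate (u : GL (Fin n) F) φ) = (whittakerCharFun ψ u)⁻¹ * Δ φ) →
      ∀ φ, Δ (SchwartzBruhat.compGKInvolution φ) = Δ φ)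
    (hA' : ∀ Δ : Module.Dual ℂ (SchwartzBruhat (GL (Fin n) F)),
      (∀ (u : ↥(upperUnitriangular (Fin n) F)) (φ : SchwartzBruhat (GL (Fin n) F)),
        Δ (SchwartzBruhat.leftTranslate (u : GL (Fin n) F) φ) = whittakerCharFun ψ⁻¹ u * Δ φ) →
      (∀ (u : ↥(upperUnitriangular (Fin n) F)) (φ : SchwartzBruhat (GL (Fin n) F)),
        Δ (SchwartzBruhat.rightTranslate (u : GL (Fin n) F) φ) = (whittakerCharFun ψ⁻¹ u)⁻¹ * Δ φ) →
      ∀ φ, Δ (SchwartzBruhat.compGKInvolution φ) = Δ φ)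
    (hM : ∃ M ∈ whittakerFunctionals π.contragredientRep ψ⁻¹, M ≠ 0) :
    Module.rank ℂ (whittakerFunctionals π ψ) ≤ 1 := by
  -- a bi-invariant regular Haar measure on `GL_n(F)`
  borelize (GL (Fin n) F)
  set μ : Measure (GL (Fin n) F) := haarMeasure (Classical.arbitrary _) with hμ
  haveI : μ.IsMulRightInvariant := isMulRightInvariant_generalLinearGroup μ
  rw [rank_submodule_le_one_iff']
  by_cases hex : ∃ Λ₁ ∈ whittakerFunctionals π ψ, Λ₁ ≠ 0
  swap
  · push Not at hex
    exact ⟨0, fun Λ hΛ => by rw [hex Λ hΛ]; exact Submodule.zero_mem _⟩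
  obtain ⟨Λ₁, hΛ₁, hΛ₁0⟩ := hex
  obtain ⟨M, hM, hM0⟩ := hM
  refine ⟨Λ₁, fun Λ₂ hΛ₂ => ?_⟩
  -- the contragredient is irreducible and admissible; reflexivity `β : V ≃ Ṽ̃`
  haveI hirr : π.contragredientRep.IsIrreducible :=
    Representation.isIrreducible_contragredient_holds π hadm
  have hadm' : π.contragredientRep.IsAdmissible :=
    Representation.isAdmissible_contragredient_holds π hadm
  set β := bidualEquiv π hadm (isOpen_glInt n F) (isCompact_glInt n F) with hβ
  -- `Λ₂ ∘ β⁻¹`, a `ψ`-Whittaker functional on `Ṽ̃`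
  set L₂ : Module.Dual ℂ π.contragredientRep.Contragredient := Λ₂ ∘ₗ β.symm.toLinearMap with hL₂
  have hL₂ψ : L₂ ∈ whittakerFunctionals π.contragredientRep.contragredientRep ψ := by
    rw [mem_whittakerFunctionals_iff]
    intro u y
    rw [hL₂, LinearMap.comp_apply, LinearEquiv.coe_toLinearMap, bidualEquiv_symm_apply,
      (mem_whittakerFunctionals_iff Λ₂).1 hΛ₂ u, LinearMap.comp_apply, LinearEquiv.coe_toLinearMap]
  -- `Λ₁ ⋆ φ = 0 ⇒ Λ₂ ⋆ φ = 0`, by two applications of the swap lemma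
  have hker : ∀ φ, hadm.isSmooth.smear μ Λ₁ φ = 0 → hadm.isSmooth.smear μ Λ₂ φ = 0 := by
    intro φ h
    have h1 : π.isSmooth_contragredientRep.smear μ M (SchwartzBruhat.compGKAutomorphism φ) = 0 :=
      smear_eq_zero_of_smear_eq_zero_pair μ ψ hadm hA hΛ₁ hΛ₁0 (whittakerCharFun_inv ψ) hM h
    have h1' : hadm'.isSmooth.smear μ M (SchwartzBruhat.compGKAutomorphism φ) = 0 := h1
    have h2 := smear_eq_zero_of_smear_eq_zero_pair μ ψ⁻¹ hadm' hA' hM hM0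
      (whittakerCharFun_eq_inv_inv ψ) hL₂ψ h1'
    rw [SchwartzBruhat.compGKAutomorphism_compGKAutomorphism] at h2
    apply LinearMap.ext
    intro v
    have h3 := LinearMap.congr_fun h2 (β v)
    rw [Representation.IsSmooth.smear_apply_apply, LinearMap.zero_apply] at h3
    rw [Representation.IsSmooth.smear_apply_apply, LinearMap.zero_apply, ← h3]
    congr 1
    funext g
    rw [hL₂, LinearMap.comp_apply, LinearEquiv.coe_toLinearMap, hβ, ← bidualEquiv_apply_apply',
      LinearEquiv.symm_apply_apply]
  set A₁ := smearVec μ hadm.isSmooth Λ₁ with hA₁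
  set A₂ := smearVec μ hadm.isSmooth Λ₂ with hA₂
  have hsurj : Function.Surjective A₁ := smearVec_surjective μ hadm hΛ₁0
  have hker' : LinearMap.ker A₁ ≤ LinearMap.ker A₂ := fun σ hσ => by
    rw [LinearMap.mem_ker] at hσ ⊢
    exact (smearVec_eq_zero_iff μ hadm.isSmooth Λ₂ σ).2
      (hker σ ((smearVec_eq_zero_iff μ hadm.isSmooth Λ₁ σ).1 hσ))
  -- the operator `T (Λ₁ ⋆ φ) = Λ₂ ⋆ φ` on `Ṽ` (4.18)
  obtain ⟨T, hT⟩ : ∃ T : π.Contragredient →ₗ[ℂ] π.Contragredient, ∀ σ, T (A₁ σ) = A₂ σ :=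
    ⟨(LinearMap.ker A₁).liftQ A₂ hker' ∘ₗ (A₁.quotKerEquivOfSurjective hsurj).symm.toLinearMap,
      fun σ => by
        rw [LinearMap.comp_apply, LinearEquiv.coe_toLinearMap,
          LinearMap.quotKerEquivOfSurjective_symm_apply, Submodule.liftQ_apply]⟩
  -- `T` is an intertwining operator of `π̃`, by (4.10)
  have hTπ : ∀ g : GL (Fin n) F, T ∘ₗ π.contragredientRep g = π.contragredientRep g ∘ₗ T := by
    intro g
    apply LinearMap.ext
    intro v
    obtain ⟨σ, rfl⟩ := hsurj v
    rw [LinearMap.comp_apply, LinearMap.comp_apply, hA₁, contragredientRep_smearVec μ hadm.isSmooth,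
      ← hA₁, hT, hT, hA₂, contragredientRep_smearVec μ hadm.isSmooth]
  -- Schur's lemma
  obtain ⟨c, hc⟩ := hadm'.exists_eq_smul_id (isOpen_glInt n F) (isCompact_glInt n F) T hTπ
  -- `Λ₂ = c Λ₁`, evaluating on bump functions
  refine Submodule.mem_span_singleton.2 ⟨c, LinearMap.ext fun ξ => ?_⟩
  obtain ⟨K, hKo, hKc, hKξ⟩ := exists_isCompact_isOpen_le_stabilizer hadm.isSmooth ξ
  set φ : SchwartzBruhat (GL (Fin n) F) := ⟨_, indicator_mem_schwartzBruhat hKo hKc⟩ with hφ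
  have h2 : A₂ φ = c • A₁ φ := by rw [← hT, hc, LinearMap.smul_apply, LinearMap.id_apply]
  have h3 : hadm.isSmooth.smear μ Λ₂ φ = c • hadm.isSmooth.smear μ Λ₁ φ := by
    rw [← subtype_smearVec μ hadm.isSmooth Λ₂, ← subtype_smearVec μ hadm.isSmooth Λ₁, ← map_smul,
      ← hA₁, ← hA₂, h2]
  have h4 := LinearMap.congr_fun h3 ξ
  rw [LinearMap.smul_apply, hadm.isSmooth.smear_indicator_apply μ Λ₂ hKo hKc hKξ,
    hadm.isSmooth.smear_indicator_apply μ Λ₁ hKo hKc hKξ, smul_eq_mul, mul_left_comm] at h4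
  have hK0 : ((μ.real (K : Set (GL (Fin n) F)) : ℂ)) ≠ 0 := by
    exact_mod_cast (measureReal_pos_of_isCompact_isOpen μ hKo hKc).ne'
  rw [LinearMap.smul_apply, smul_eq_mul]
  exact (mul_left_cancel₀ hK0 h4).symm

/-! #### Supercuspidal representations -/

/-- **Uniqueness of Whittaker functionals for supercuspidal representations, from the
Gelfand–Kazhdan lemma** (Gelfand–Kazhdan 1975; Bernstein–Zelevinsky 1977, Thm. 4.4 (b):
"if `π` is irreducible and quasi-cuspidal then `π^{(n)}` is one-dimensional"). For an irreducible
smooth supercuspidal `π` and a non-trivial continuous `ψ`, hypothesis (A) (Bump's Thm. 4.4.2) for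
`ψ` and `ψ⁻¹` implies `dim Hom_{U_n}(π, ψ_U) ≤ 1`: `π` is admissible
(`IsSupercuspidal.isAdmissible_of_sigmaCompactSpace`), its contragredient is irreducible, smooth
and supercuspidal (`IsSupercuspidal.contragredientRep`), hence `ψ⁻¹`-generic
(`isGeneric_of_isSupercuspidal_holds`), and `rank_whittakerFunctionals_le_one_of_gelfandKazhdan_pair`
applies. Theorem B of Gelfand–Kazhdan is not needed. [cite: GelfandKazhdan1975, §2]
[cite: BernsteinZelevinskyASENS1977, Theorem 4.4] -/
theorem rank_whittakerFunctionals_le_one_of_isSupercuspidal_of_gelfandKazhdan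
    (π : Representation ℂ (GL (Fin n) F) V) (ψ : AddChar F Circle) [π.IsIrreducible]
    (hπ : π.IsSmooth) (hsc : π.IsSupercuspidal) (hψ : ψ.IsContinuousNontrivial)
    (hA : ∀ Δ : Module.Dual ℂ (SchwartzBruhat (GL (Fin n) F)),
      (∀ (u : ↥(upperUnitriangular (Fin n) F)) (φ : SchwartzBruhat (GL (Fin n) F)),
        Δ (SchwartzBruhat.leftTranslate (u : GL (Fin n) F) φ) = whittakerCharFun ψ u * Δ φ) →
      (∀ (u : ↥(upperUnitriangular (Fin n) F)) (φ : SchwartzBruhat (GL (Fin n) F)),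
        Δ (SchwartzBruhat.rightTranslate (u : GL (Fin n) F) φ) = (whittakerCharFun ψ u)⁻¹ * Δ φ) →
      ∀ φ, Δ (SchwartzBruhat.compGKInvolution φ) = Δ φ)
    (hA' : ∀ Δ : Module.Dual ℂ (SchwartzBruhat (GL (Fin n) F)),
      (∀ (u : ↥(upperUnitriangular (Fin n) F)) (φ : SchwartzBruhat (GL (Fin n) F)),
        Δ (SchwartzBruhat.leftTranslate (u : GL (Fin n) F) φ) = whittakerCharFun ψ⁻¹ u * Δ φ) →
      (∀ (u : ↥(upperUnitriangular (Fin n) F)) (φ : SchwartzBruhat (GL (Fin n) F)),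
        Δ (SchwartzBruhat.rightTranslate (u : GL (Fin n) F) φ) = (whittakerCharFun ψ⁻¹ u)⁻¹ * Δ φ) →
      ∀ φ, Δ (SchwartzBruhat.compGKInvolution φ) = Δ φ) :
    Module.rank ℂ (whittakerFunctionals π ψ) ≤ 1 := by
  have hadm : π.IsAdmissible := Representation.IsSupercuspidal.isAdmissible_of_sigmaCompactSpace hπ hsc
  haveI hirr : π.contragredientRep.IsIrreducible :=
    Representation.isIrreducible_contragredient_holds π hadm
  have hsc' : π.contragredientRep.IsSupercuspidal :=
    hsc.contragredientRep hadm (isOpen_glInt n F) (isCompact_glInt n F)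
  have hgen : IsGeneric π.contragredientRep ψ⁻¹ :=
    isGeneric_of_isSupercuspidal_holds π.contragredientRep ψ⁻¹ π.isSmooth_contragredientRep hsc'
      hψ.inv
  exact rank_whittakerFunctionals_le_one_of_gelfandKazhdan_pair π ψ hadm hA hA'
    ((isGeneric_iff _ _).1 hgen)

end PairCriterion

end Literature.NumberTheory.Automorphic
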